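import Mathlib
import Summits.CriticalPhenomena.PercolationContinuityZ3.Theorems.PercNearOneGluingNearOneGluingBhkLogSupermodular
import HarnessLib

/-!
# Crux `PercNearOneGluing.NearOneGluing` (stmt-CriticalPhenomena-4574), line `SketchR2I5` — the EXCLUSIVITY LEMMA

Lead prover-line-stmt-CriticalPhenomena-4574-c2-0, 2026-08-16.  Lands with `--supports stmt-CriticalPhenomena-4574`.

## Content (all `|A|`-free; the only percolation input is the landed BHK log-supermodularity `stub_bhkLogSupermodular`)

* `prod_le_pow_of_logSupermodular` — ABSTRACT: a set function `g ≥ 0`, `≤ 1`, antitone and LOG-SUPERMODULAR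
  (`g X · g Y ≤ g (X ∩ Y) · g (X ∪ Y)`) on the subsets of `U` satisfies, for every finite family `Q_j ⊆ U` (`j ∈ J`,
  `J ≠ ∅`), with `S_j := ⋃_{k ∈ J, k ≠ j} Q_k` and `Q := ⋃_{k ∈ J} Q_k`:   `∏_{j ∈ J} g S_j ≤ (g Q) ^ (|J| - 1)`.
  (The sets `S_j` cover every point of `Q` exactly `|J| - 1` times; this is the fractional-subadditivity / Shearer-type
  consequence of submodularity of `-log g`, proved by a direct induction.)
* `sum_le_two_mul_log_of_prod_le` — ARITHMETIC: if `0 < p < 1`, `e_j ≥ 0`, `∏_{j∈J} (p + e_j) ≤ p ^ (|J| - 1)` and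
  `e_j ≤ η` then `∑_j e_j ≤ 2 (p + η) log (1/p)`  (split `e_j/p ≤ 1`, where `log (1+r) ≥ r/2`, from `e_j/p > 1`, where
  `log (1+r) ≥ log 2 ≥ 1/2`).
* `avoid_prod_le_pow` — PERCOLATION: for `μ = prodBernoulli w` on bond configurations of `Fin n`, a vertex `s` and target
  sets `Q_j ∌ s`:  `∏_j μ(s ↮ S_j) ≤ μ(s ↮ Q) ^ (|J| - 1)`, because `T ↦ μ(s ↮ T)` is log-supermodular by BHK
  (`stub_bhkLogSupermodular` with both events `= univ`) and antitone.  For `|J| = 2` this is Harris.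
* `exclusivity` — the EXCLUSIVITY LEMMA: with `p₀ := μ(s ↮ Q)` and `e_j := μ(s ↔ Q_j, s ↮ S_j)` ("the cluster of `s`
  meets exactly the `j`-th target"), `μ(s ↮ S_j) = p₀ + e_j`, hence `∏ (p₀ + e_j) ≤ p₀^{|J|-1}` and
  `∑_j e_j ≤ 2 (p₀ + η) log (1/p₀)` for any `η ≥ max_j e_j`: balanced exclusivity among many targets is impossible
  unless the cluster of `s` misses all targets with comparable probability.
  Gluing reading (targets `{b}` and a partition `Q_1, …, Q_J` of the relay set `A`, source `s = o`):
  `∑_j μ(o ↮ b, ∅ ≠ C(o) ∩ A ⊆ Q_j) ≤ 2 (μ(o ↮ A ∪ {b}) + η) · log (1 / μ(o ↮ A ∪ {b}))` — bad mass that is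
  "monochromatic" for a partition of the relays is `O((δ + η) log (1/δ))`; with the accumulation budget this bounds the bad
  mass carried by ANY laminar family of footprints by `2√(δ · bad · L) + 2 δ L` (`L = log(1/δ)`), so the tree/poset
  enemy of the crux notes (§B) is excluded by BHK alone (Cruxes/NearOneGluing/NOTES.md §C).
-/

namespace Summit.CriticalPhenomena.PercolationContinuityZ3.Theorems

open scoped BigOperators
open MeasureTheory Set
open Literature.Probability.LatticeModels (prodBernoulli)
open Literature.Probability.Percolation

/-! ## 1. The abstract product inequality for log-supermodular antitone set functions -/

section Abstract

variable {α ι : Type*} [DecidableEq ι]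

/-- **`(|J|-1)`-fold cover inequality for a log-supermodular antitone set function** (abstract form of the
exclusivity lemma).  If `g` is nonnegative, at most `1`, antitone and log-supermodular on the subsets of `U`, then for
every nonempty finite family `Q_j ⊆ U`: `∏_{j∈J} g (⋃_{k∈J∖{j}} Q_k) ≤ g (⋃_{k∈J} Q_k) ^ (|J|-1)`.
[cite: VandenbergHaggstromKahn2005, Thm 1.1 (source of log-supermodularity); folklore (submodular ⇒ fractionally subadditive)] -/
theorem prod_le_pow_of_logSupermodular (U : Set α) (g : Set α → ℝ)
    (h0 : ∀ T, T ⊆ U → 0 ≤ g T) (h1 : ∀ T, T ⊆ U → g T ≤ 1)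
    (hmono : ∀ T T', T ⊆ T' → T' ⊆ U → g T' ≤ g T)
    (hlsm : ∀ X Y, X ⊆ U → Y ⊆ U → g X * g Y ≤ g (X ∩ Y) * g (X ∪ Y))
    (Q : ι → Set α) (J : Finset ι) (hQ : ∀ j ∈ J, Q j ⊆ U) (hJ : J.Nonempty) :
    ∏ j ∈ J, g (⋃ k ∈ J.erase j, Q k) ≤ g (⋃ k ∈ J, Q k) ^ (J.card - 1) := by
  classical
  -- notation
  set Qall : Set α := ⋃ k ∈ J, Q k with hQall
  have hQallU : Qall ⊆ U := by
    intro x hx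
    simp only [hQall, Set.mem_iUnion, exists_prop] at hx
    obtain ⟨k, hk, hxk⟩ := hx
    exact hQ k hk hxk
  let S : ι → Set α := fun j => ⋃ k ∈ J.erase j, Q k
  let T : Finset ι → Set α := fun I => ⋃ k ∈ J \ I, Q k
  have hS_sub : ∀ j, S j ⊆ Qall := by
    intro j x hx
    simp only [S, Set.mem_iUnion, exists_prop] at hx
    obtain ⟨k, hk, hxk⟩ := hx
    exact Set.mem_iUnion₂.2 ⟨k, (Finset.mem_erase.1 hk).2, hxk⟩
  have hT_sub : ∀ I, T I ⊆ Qall := by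
    intro I x hx
    simp only [T, Set.mem_iUnion, exists_prop] at hx
    obtain ⟨k, hk, hxk⟩ := hx
    exact Set.mem_iUnion₂.2 ⟨k, (Finset.mem_sdiff.1 hk).1, hxk⟩
  have hgQ_nn : 0 ≤ g Qall := h0 _ hQallU
  -- generalized claim, by induction on `I ⊆ J`
  have key : ∀ I : Finset ι, I ⊆ J → I.Nonempty →
      ∏ j ∈ I, g (S j) ≤ g Qall ^ (I.card - 1) * g (T I) := by
    intro I
    induction I using Finset.induction_on with
    | empty => intro _ h; exact absurd h Finset.not_nonempty_empty
    | @insert i I hiI ih =>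
      intro hsub _
      have hiJ : i ∈ J := hsub (Finset.mem_insert_self i I)
      have hIJ : I ⊆ J := fun x hx => hsub (Finset.mem_insert_of_mem hx)
      rw [Finset.prod_insert hiI, Finset.card_insert_of_notMem hiI]
      by_cases hI : I.Nonempty
      · -- inductive step
        have hih := ih hIJ hI
        have hgS_nn : 0 ≤ g (S i) := h0 _ ((hS_sub i).trans hQallU)
        -- g(S i) * g(T I) ≤ g(T (insert i I)) * g(Qall)
        have hstep : g (S i) * g (T I) ≤ g (T (insert i I)) * g Qall := by
          have h1' := hlsm (S i) (T I) ((hS_sub i).trans hQallU) ((hT_sub I).trans hQallU)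
          have h2' : g (S i ∩ T I) ≤ g (T (insert i I)) := by
            refine hmono _ _ ?_ ((Set.inter_subset_left).trans ((hS_sub i).trans hQallU))
            intro x hx
            simp only [T, Set.mem_iUnion, exists_prop] at hx
            obtain ⟨k, hk, hxk⟩ := hx
            have hk' := Finset.mem_sdiff.1 hk
            have hki : k ≠ i := fun h => hk'.2 (h ▸ Finset.mem_insert_self i I)
            have hkI : k ∉ I := fun h => hk'.2 (Finset.mem_insert_of_mem h)
            refine ⟨?_, ?_⟩
            · exact Set.mem_iUnion₂.2 ⟨k, Finset.mem_erase.2 ⟨hki, hk'.1⟩, hxk⟩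
            · exact Set.mem_iUnion₂.2 ⟨k, Finset.mem_sdiff.2 ⟨hk'.1, hkI⟩, hxk⟩
          have h3' : g (S i ∪ T I) ≤ g Qall := by
            refine hmono _ _ ?_ (Set.union_subset ((hS_sub i).trans hQallU) ((hT_sub I).trans hQallU))
            intro x hx
            simp only [hQall, Set.mem_iUnion, exists_prop] at hx
            obtain ⟨k, hk, hxk⟩ := hx
            by_cases hki : k = i
            · right
              exact Set.mem_iUnion₂.2 ⟨k, Finset.mem_sdiff.2 ⟨hk, hki ▸ hiI⟩, hxk⟩
            · left
              exact Set.mem_iUnion₂.2 ⟨k, Finset.mem_erase.2 ⟨hki, hk⟩, hxk⟩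
          have hgi_nn : 0 ≤ g (S i ∩ T I) :=
            h0 _ ((Set.inter_subset_left).trans ((hS_sub i).trans hQallU))
          have hgT_nn : 0 ≤ g (T (insert i I)) := h0 _ ((hT_sub _).trans hQallU)
          calc g (S i) * g (T I) ≤ g (S i ∩ T I) * g (S i ∪ T I) := h1'
            _ ≤ g (T (insert i I)) * g Qall :=
                mul_le_mul h2' h3' (h0 _ (Set.union_subset ((hS_sub i).trans hQallU)
                  ((hT_sub I).trans hQallU))) hgT_nn
        have hgTI_nn : 0 ≤ g (T I) := h0 _ ((hT_sub I).trans hQallU)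
        calc g (S i) * ∏ j ∈ I, g (S j)
            ≤ g (S i) * (g Qall ^ (I.card - 1) * g (T I)) :=
              mul_le_mul_of_nonneg_left hih hgS_nn
          _ = g Qall ^ (I.card - 1) * (g (S i) * g (T I)) := by ring
          _ ≤ g Qall ^ (I.card - 1) * (g (T (insert i I)) * g Qall) :=
              mul_le_mul_of_nonneg_left hstep (pow_nonneg hgQ_nn _)
          _ = g Qall ^ (I.card - 1 + 1) * g (T (insert i I)) := by ring
          _ = g Qall ^ (I.card + 1 - 1) * g (T (insert i I)) := by
              rw [Nat.sub_add_cancel (Finset.card_pos.2 hI), Nat.add_sub_cancel]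
      · -- base case: I = ∅, a single index
        have hI' : I = ∅ := Finset.not_nonempty_iff_eq_empty.1 hI
        subst hI'
        simp only [Finset.prod_empty, mul_one, Finset.card_empty, zero_add, Nat.sub_self, pow_zero, one_mul]
        refine hmono _ _ ?_ ((hS_sub i).trans hQallU)
        intro x hx
        simp only [T, Set.mem_iUnion, exists_prop] at hx
        obtain ⟨k, hk, hxk⟩ := hx
        have hk' := Finset.mem_sdiff.1 hk
        have hki : k ≠ i := fun h => hk'.2 (h ▸ Finset.mem_insert_self i ∅)
        exact Set.mem_iUnion₂.2 ⟨k, Finset.mem_erase.2 ⟨hki, hk'.1⟩, hxk⟩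
  have hfin := key J (Finset.Subset.refl J) hJ
  have hTJ : g (T J) ≤ 1 := h1 _ ((hT_sub J).trans hQallU)
  calc ∏ j ∈ J, g (S j) ≤ g Qall ^ (J.card - 1) * g (T J) := hfin
    _ ≤ g Qall ^ (J.card - 1) * 1 :=
        mul_le_mul_of_nonneg_left hTJ (pow_nonneg hgQ_nn _)
    _ = g Qall ^ (J.card - 1) := mul_one _

end Abstract

/-! ## 2. The arithmetic step: a product bound `∏ (p + e_j) ≤ p^{|J|-1}` forces `∑ e_j = O((p + max e) log(1/p))` -/

section Arithmetic

variable {ι : Type*}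

/-- **Arithmetic step of the exclusivity lemma.**  If `0 < p < 1`, `0 ≤ e_j ≤ η` and
`∏_{j∈J} (p + e_j) ≤ p ^ (|J|-1)` (`J ≠ ∅`), then `∑_{j∈J} e_j ≤ 2 (p + η) log (1/p)`. [folklore] -/
theorem sum_le_two_mul_log_of_prod_le (J : Finset ι) (hJ : J.Nonempty) (p η : ℝ) (hp0 : 0 < p) (hp1 : p < 1)
    (e : ι → ℝ) (he0 : ∀ j ∈ J, 0 ≤ e j) (heη : ∀ j ∈ J, e j ≤ η)
    (hprod : ∏ j ∈ J, (p + e j) ≤ p ^ (J.card - 1)) :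
    ∑ j ∈ J, e j ≤ 2 * (p + η) * Real.log (1 / p) := by
  classical
  have hη : 0 ≤ η := by
    obtain ⟨j, hj⟩ := hJ
    exact (he0 j hj).trans (heη j hj)
  set L := Real.log (1 / p) with hL
  have hL0 : 0 ≤ L := Real.log_nonneg (by rw [le_div_iff₀ hp0]; linarith)
  -- two elementary logarithm bounds (kept local)
  have half_le_log_one_add : ∀ {r : ℝ}, 0 ≤ r → r ≤ 1 → r / 2 ≤ Real.log (1 + r) := by
    intro r hr0 hr1
    have hpos : 0 < 1 + r := by linarith
    have h := Real.one_sub_inv_le_log_of_pos hpos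
    have h2 : r / 2 ≤ 1 - (1 + r)⁻¹ := by
      rw [div_le_iff₀ (by norm_num : (0:ℝ) < 2)]
      have : (1 + r)⁻¹ = 1 / (1 + r) := (one_div _).symm
      rw [this, sub_mul, one_div_mul_eq_div]
      rw [show (1:ℝ) * 2 - 2 / (1 + r) = (2 * r) / (1 + r) by field_simp; ring]
      rw [le_div_iff₀ hpos]
      nlinarith
    linarith
  have half_le_log_two : (1 : ℝ) / 2 ≤ Real.log 2 := by
    have := Real.log_two_gt_d9
    linarith
  -- the ratio form: ∏ (1 + e_j / p) ≤ 1 / p, i.e. ∑ log (1 + r_j) ≤ L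
  let r : ι → ℝ := fun j => e j / p
  have hr0 : ∀ j ∈ J, 0 ≤ r j := fun j hj => div_nonneg (he0 j hj) hp0.le
  have hfac : ∀ j ∈ J, p + e j = p * (1 + r j) := by
    intro j _
    simp only [r]
    field_simp
  have hprod' : p ^ J.card * ∏ j ∈ J, (1 + r j) ≤ p ^ (J.card - 1) := by
    have : ∏ j ∈ J, (p + e j) = p ^ J.card * ∏ j ∈ J, (1 + r j) := by
      rw [Finset.prod_congr rfl hfac, Finset.prod_mul_distrib, Finset.prod_const]
    rw [← this]
    exact hprod
  have hcard : 1 ≤ J.card := Finset.card_pos.2 hJ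
  have hprod'' : ∏ j ∈ J, (1 + r j) ≤ 1 / p := by
    -- divide by p ^ J.card > 0
    have hpk : 0 < p ^ J.card := pow_pos hp0 _
    rw [le_div_iff₀ hp0]
    have : p ^ J.card = p ^ (J.card - 1) * p := by
      rw [← pow_succ, Nat.sub_add_cancel hcard]
    have h2 : (∏ j ∈ J, (1 + r j)) * p * p ^ (J.card - 1) ≤ 1 * p ^ (J.card - 1) := by
      calc (∏ j ∈ J, (1 + r j)) * p * p ^ (J.card - 1)
          = p ^ J.card * ∏ j ∈ J, (1 + r j) := by rw [this]; ring
        _ ≤ p ^ (J.card - 1) := hprod'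
        _ = 1 * p ^ (J.card - 1) := (one_mul _).symm
    exact le_of_mul_le_mul_right h2 (pow_pos hp0 _)
  have hsumlog : ∑ j ∈ J, Real.log (1 + r j) ≤ L := by
    have hpos : ∀ j ∈ J, (1 + r j) ≠ 0 := fun j hj => by have := hr0 j hj; positivity
    rw [← Real.log_prod hpos]
    exact Real.log_le_log (Finset.prod_pos fun j hj => by have := hr0 j hj; positivity) hprod''
  -- split the index set
  let J₁ := J.filter fun j => r j ≤ 1
  let J₂ := J.filter fun j => ¬ r j ≤ 1
  have hsplit_log : ∑ j ∈ J₁, Real.log (1 + r j) + ∑ j ∈ J₂, Real.log (1 + r j) =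
      ∑ j ∈ J, Real.log (1 + r j) := Finset.sum_filter_add_sum_filter_not J _ _
  have hlog_nn : ∀ j ∈ J, 0 ≤ Real.log (1 + r j) := fun j hj =>
    Real.log_nonneg (by have := hr0 j hj; linarith)
  have h1sum : ∑ j ∈ J₁, r j / 2 ≤ ∑ j ∈ J₁, Real.log (1 + r j) :=
    Finset.sum_le_sum fun j hj => by
      have hj' := Finset.mem_filter.1 hj
      exact half_le_log_one_add (hr0 j hj'.1) hj'.2
  have h2sum : ∑ j ∈ J₂, (1 : ℝ) / 2 ≤ ∑ j ∈ J₂, Real.log (1 + r j) :=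
    Finset.sum_le_sum fun j hj => by
      have hj' := Finset.mem_filter.1 hj
      have hrj : 1 < r j := lt_of_not_ge hj'.2
      calc (1 : ℝ) / 2 ≤ Real.log 2 := half_le_log_two
        _ ≤ Real.log (1 + r j) := Real.log_le_log (by norm_num) (by linarith)
  have h1nn : 0 ≤ ∑ j ∈ J₁, Real.log (1 + r j) :=
    Finset.sum_nonneg fun j hj => hlog_nn j (Finset.mem_filter.1 hj).1
  have h2nn : 0 ≤ ∑ j ∈ J₂, Real.log (1 + r j) :=
    Finset.sum_nonneg fun j hj => hlog_nn j (Finset.mem_filter.1 hj).1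
  have hA : ∑ j ∈ J₁, r j ≤ 2 * L := by
    have : ∑ j ∈ J₁, r j / 2 ≤ L := by linarith
    have h' : ∑ j ∈ J₁, r j / 2 = (∑ j ∈ J₁, r j) / 2 := by rw [Finset.sum_div]
    rw [h'] at this
    linarith
  have hB : (J₂.card : ℝ) ≤ 2 * L := by
    have : ∑ j ∈ J₂, (1 : ℝ) / 2 ≤ L := by linarith
    rw [Finset.sum_const, nsmul_eq_mul] at this
    linarith
  -- assemble
  have hsplit_e : ∑ j ∈ J, e j = ∑ j ∈ J₁, e j + ∑ j ∈ J₂, e j :=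
    (Finset.sum_filter_add_sum_filter_not J _ _).symm
  have hE1 : ∑ j ∈ J₁, e j = p * ∑ j ∈ J₁, r j := by
    rw [Finset.mul_sum]
    refine Finset.sum_congr rfl fun j _ => ?_
    simp only [r]
    field_simp
  have hE2 : ∑ j ∈ J₂, e j ≤ J₂.card * η := by
    have : ∑ j ∈ J₂, e j ≤ ∑ j ∈ J₂, η := Finset.sum_le_sum fun j hj => heη j (Finset.mem_filter.1 hj).1
    rwa [Finset.sum_const, nsmul_eq_mul] at this
  calc ∑ j ∈ J, e j = ∑ j ∈ J₁, e j + ∑ j ∈ J₂, e j := hsplit_e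
    _ ≤ p * (2 * L) + (2 * L) * η := by
        rw [hE1]
        have := mul_le_mul_of_nonneg_left hA hp0.le
        have h' : (J₂.card : ℝ) * η ≤ (2 * L) * η := mul_le_mul_of_nonneg_right hB hη
        linarith
    _ = 2 * (p + η) * L := by ring

end Arithmetic

/-! ## 3. Percolation: the avoidance function is log-supermodular (BHK) and antitone -/

section Percolation

variable {n : ℕ}

/-- **Log-supermodularity of avoidance** (BHK 2006 Thm 1.1 with both events trivial):
`μ(s ↮ X) μ(s ↮ Y) ≤ μ(s ↮ X ∩ Y) μ(s ↮ X ∪ Y)` for `s ∉ X, Y`; equivalently `T ↦ -log μ(s ↮ T)` is submodular.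
[cite: VandenbergHaggstromKahn2005, Thm 1.1] -/
theorem avoid_logSupermodular (w : Sym2 (Fin n) → unitInterval) (s : Fin n) (X Y : Set (Fin n))
    (hX : s ∉ X) (hY : s ∉ Y) :
    (prodBernoulli w).real {ω | ∀ x ∈ X, ¬ (openGraph ω).Reachable s x} *
        (prodBernoulli w).real {ω | ∀ y ∈ Y, ¬ (openGraph ω).Reachable s y} ≤
      (prodBernoulli w).real {ω | ∀ z ∈ X ∩ Y, ¬ (openGraph ω).Reachable s z} *
        (prodBernoulli w).real {ω | ∀ z ∈ X ∪ Y, ¬ (openGraph ω).Reachable s z} := by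
  have h := stub_bhkLogSupermodular n w s X Y Set.univ Set.univ (fun _ _ _ _ => Set.mem_univ _)
    (fun _ _ _ _ => Set.mem_univ _) hX hY
  simpa only [Set.univ_inter] using h

/-- Avoidance is antitone in the target set: `T ⊆ T'` gives `μ(s ↮ T') ≤ μ(s ↮ T)`. [folklore] -/
theorem avoid_antitone (w : Sym2 (Fin n) → unitInterval) (s : Fin n) {T T' : Set (Fin n)} (h : T ⊆ T') :
    (prodBernoulli w).real {ω | ∀ z ∈ T', ¬ (openGraph ω).Reachable s z} ≤
      (prodBernoulli w).real {ω | ∀ z ∈ T, ¬ (openGraph ω).Reachable s z} :=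
  measureReal_mono (fun _ hω z hz => hω z (h hz)) (measure_ne_top _ _)

/-- **Product form of the exclusivity lemma.**  For a vertex `s` and a nonempty finite family of target sets
`Q_j ∌ s`, with `S_j = ⋃_{k≠j} Q_k` and `Q = ⋃_k Q_k`:  `∏_{j∈J} μ(s ↮ S_j) ≤ μ(s ↮ Q)^{|J|-1}`.
For `|J| = 2` this is Harris' inequality for the two decreasing events `{s ↮ Q₁}`, `{s ↮ Q₂}`; in general it is the
`(|J|-1)`-fold cover inequality of the submodular function `-log μ(s ↮ ·)`.
[cite: VandenbergHaggstromKahn2005, Thm 1.1] -/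
theorem avoid_prod_le_pow {ι : Type*} [DecidableEq ι] (w : Sym2 (Fin n) → unitInterval) (s : Fin n) (Q : ι → Set (Fin n))
    (J : Finset ι) (hs : ∀ j ∈ J, s ∉ Q j) (hJ : J.Nonempty) :
    ∏ j ∈ J, (prodBernoulli w).real {ω | ∀ z ∈ ⋃ k ∈ J.erase j, Q k, ¬ (openGraph ω).Reachable s z} ≤
      ((prodBernoulli w).real {ω | ∀ z ∈ ⋃ k ∈ J, Q k, ¬ (openGraph ω).Reachable s z}) ^ (J.card - 1) := by
  refine prod_le_pow_of_logSupermodular ({s}ᶜ : Set (Fin n))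
    (fun T => (prodBernoulli w).real {ω | ∀ z ∈ T, ¬ (openGraph ω).Reachable s z})
    (fun T _ => measureReal_nonneg) (fun T _ => measureReal_le_one) (fun T T' hTT' _ => avoid_antitone w s hTT')
    (fun X Y hX hY => avoid_logSupermodular w s X Y (fun h => hX h rfl) (fun h => hY h rfl)) Q J
    (fun j hj x hx hxs => hs j hj (by rw [Set.mem_singleton_iff.1 hxs] at hx; exact hx)) hJ

/-- **The exclusivity lemma** (crux anatomy, `|A|`-free).  For a vertex `s`, a finite family of target sets
`Q_j ∌ s` (`|J| ≥ 1`), `S_j = ⋃_{k≠j} Q_k`, `Q = ⋃ Q_k`, put `p₀ = μ(s ↮ Q)` and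
`e_j = μ(s ↔ Q_j, s ↮ S_j)` (the cluster of `s` meets exactly the `j`-th target class).  If `0 < p₀ < 1` and
`e_j ≤ η` for all `j`, then `∑_j e_j ≤ 2 (p₀ + η) log (1/p₀)`.  Reading for the gluing problem: targets `{b}` and the
blocks of a partition of the relay set; `p₀ = μ(o ↮ A ∪ {b}) ≤ μ(o ↮ A) ≤ δ` (WLOG `≥ δ/2`), `e_j` = bad mass whose
footprint lies inside block `j` — monochromatic bad mass is `O((δ + η) log(1/δ))`, which excludes every laminar
("tree of pockets") enemy.  [cite: VandenbergHaggstromKahn2005, Thm 1.1; KozmaNitzan2024, Conj. 3 p.15 (context)] -/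
theorem exclusivity_family {ι : Type*} [DecidableEq ι] (w : Sym2 (Fin n) → unitInterval) (s : Fin n) (Q : ι → Set (Fin n))
    (J : Finset ι) (hs : ∀ j ∈ J, s ∉ Q j) (hJ : J.Nonempty) (η : ℝ)
    (hp0 : 0 < (prodBernoulli w).real {ω | ∀ z ∈ ⋃ k ∈ J, Q k, ¬ (openGraph ω).Reachable s z})
    (hp1 : (prodBernoulli w).real {ω | ∀ z ∈ ⋃ k ∈ J, Q k, ¬ (openGraph ω).Reachable s z} < 1)
    (hη : ∀ j ∈ J, (prodBernoulli w).real
        ({ω | ∃ z ∈ Q j, (openGraph ω).Reachable s z} ∩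
          {ω | ∀ z ∈ ⋃ k ∈ J.erase j, Q k, ¬ (openGraph ω).Reachable s z}) ≤ η) :
    ∑ j ∈ J, (prodBernoulli w).real
        ({ω | ∃ z ∈ Q j, (openGraph ω).Reachable s z} ∩
          {ω | ∀ z ∈ ⋃ k ∈ J.erase j, Q k, ¬ (openGraph ω).Reachable s z}) ≤
      2 * ((prodBernoulli w).real {ω | ∀ z ∈ ⋃ k ∈ J, Q k, ¬ (openGraph ω).Reachable s z} + η) *
        Real.log (1 / (prodBernoulli w).real {ω | ∀ z ∈ ⋃ k ∈ J, Q k, ¬ (openGraph ω).Reachable s z}) := by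
  classical
  set μ := prodBernoulli w with hμ
  set p₀ := μ.real {ω | ∀ z ∈ ⋃ k ∈ J, Q k, ¬ (openGraph ω).Reachable s z} with hp₀
  let Av : ι → Set (Set (Sym2 (Fin n))) := fun j =>
    {ω | ∀ z ∈ ⋃ k ∈ J.erase j, Q k, ¬ (openGraph ω).Reachable s z}
  let Hit : ι → Set (Set (Sym2 (Fin n))) := fun j => {ω | ∃ z ∈ Q j, (openGraph ω).Reachable s z}
  let e : ι → ℝ := fun j => μ.real (Hit j ∩ Av j)
  change ∑ j ∈ J, e j ≤ 2 * (p₀ + η) * Real.log (1 / p₀)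
  -- decomposition μ(Av j) = p₀ + e j
  have hdecomp : ∀ j ∈ J, μ.real (Av j) = p₀ + e j := by
    intro j hj
    have hunion : Av j = {ω | ∀ z ∈ ⋃ k ∈ J, Q k, ¬ (openGraph ω).Reachable s z} ∪ (Hit j ∩ Av j) := by
      ext ω
      simp only [Av, Hit, Set.mem_union, Set.mem_inter_iff, Set.mem_setOf_eq]
      constructor
      · intro hω
        by_cases hhit : ∃ z ∈ Q j, (openGraph ω).Reachable s z
        · exact Or.inr ⟨hhit, hω⟩
        · left
          intro z hz
          simp only [Set.mem_iUnion, exists_prop] at hz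
          obtain ⟨k, hk, hzk⟩ := hz
          by_cases hkj : k = j
          · subst hkj
            exact fun h => hhit ⟨z, hzk, h⟩
          · exact hω z (Set.mem_iUnion₂.2 ⟨k, Finset.mem_erase.2 ⟨hkj, hk⟩, hzk⟩)
      · rintro (hω | ⟨_, hω⟩)
        · intro z hz
          simp only [Set.mem_iUnion, exists_prop] at hz
          obtain ⟨k, hk, hzk⟩ := hz
          exact hω z (Set.mem_iUnion₂.2 ⟨k, (Finset.mem_erase.1 hk).2, hzk⟩)
        · exact hω
    have hdisj : Disjoint {ω | ∀ z ∈ ⋃ k ∈ J, Q k, ¬ (openGraph ω).Reachable s z} (Hit j ∩ Av j) := by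
      rw [Set.disjoint_left]
      rintro _ hω ⟨⟨z, hzQ, hzr⟩, _⟩
      exact hω z (Set.mem_iUnion₂.2 ⟨j, hj, hzQ⟩) hzr
    rw [hunion, measureReal_union hdisj MeasurableSet.of_discrete]
  -- the product inequality in the (p₀ + e_j) form
  have hprod : ∏ j ∈ J, (p₀ + e j) ≤ p₀ ^ (J.card - 1) := by
    have h := avoid_prod_le_pow w s Q J hs hJ
    rw [Finset.prod_congr rfl (fun j hj => (hdecomp j hj).symm)]
    exact h
  exact sum_le_two_mul_log_of_prod_le J hJ p₀ η hp0 hp1 e (fun j _ => measureReal_nonneg) hη hprod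

/-- **The exclusivity lemma, registered form** (targets indexed by `ℕ`; see `exclusivity_family` for an arbitrary
index type and the docstring there for the gluing reading).  With `p₀ = μ(s ↮ ⋃ Q_k)` and
`e_j = μ(s ↔ Q_j, s ↮ ⋃_{k≠j} Q_k)`:  `0 < p₀ < 1`, `e_j ≤ η` ⇒ `∑_j e_j ≤ 2 (p₀ + η) log (1/p₀)`.
[cite: VandenbergHaggstromKahn2005, Thm 1.1; KozmaNitzan2024, Conj. 3 p.15 (context)] -/
theorem exclusivity : ∀ (n : ℕ) (w : Sym2 (Fin n) → unitInterval) (s : Fin n) (Q : ℕ → Set (Fin n)) (J : Finset ℕ), (∀ j ∈ J, s ∉ Q j) → J.Nonempty → ∀ (η : ℝ), 0 < (Literature.Probability.LatticeModels.prodBernoulli w).real {ω | ∀ z ∈ ⋃ k ∈ J, Q k, ¬ (Literature.Probability.Percolation.openGraph ω).Reachable s z} → (Literature.Probability.LatticeModels.prodBernoulli w).real {ω | ∀ z ∈ ⋃ k ∈ J, Q k, ¬ (Literature.Probability.Percolation.openGraph ω).Reachable s z} < 1 → (∀ j ∈ J, (Literature.Probability.LatticeModels.prodBernoulli w).real ({ω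 | ∃ z ∈ Q j, (Literature.Probability.Percolation.openGraph ω).Reachable s z} ∩ {ω | ∀ z ∈ ⋃ k ∈ J.erase j, Q k, ¬ (Literature.Probability.Percolation.openGraph ω).Reachable s z}) ≤ η) → ∑ j ∈ J, (Literature.Probability.LatticeModels.prodBernoulli w).real ({ω | ∃ z ∈ Q j, (Literature.Probability.Percolation.openGraph ω).Reachable s z} ∩ {ω | ∀ z ∈ ⋃ k ∈ J.erase j, Q k, ¬ (Literature.Probability.Percolation.openGraph ω).Reachable s z}) ≤ 2 * ((Literature.Probability.LatticeModels.prodBernoulli w).real {ω | ∀ z ∈ ⋃ k ∈ J, Q k, ¬ (Literature.Probability.Percolation.openGraph ω).Reachable s z} + η) * Real.log (1 / (Literature.Probability.LatticeModels.prodBernoulli w).real {ω | ∀ z ∈ ⋃ k ∈ J, Q k, ¬ (Literature.Probability.Percolation.openGraph ω).Reachable s z}) :=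
  fun _ w s Q J hs hJ η hp0 hp1 hη => exclusivity_family w s Q J hs hJ η hp0 hp1 hη

end Percolation

end Summit.CriticalPhenomena.PercolationContinuityZ3.Theorems
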